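import Literature.Geometry.Lorentzian.CoordRoundDefectTensor
import Literature.Geometry.Lorentzian.CoordInnerLaplacian
import HarnessLib

/-!
# Pointwise bounds for `∗`-contractions and the static `Rm`, `∇Rm` calculus in coordinates

Towards the second half of Munteanu–Wang 2015, Thm. 1.4 (`|∇Rm|` is bounded on a complete
four-dimensional gradient shrinking Ricci soliton with bounded scalar curvature; the Shi-type
estimate of p. 6 and Prop. 2.2 with formula (u1), `Δ_f ∇Rm = ∇Rm + Rm ∗ ∇Rm`), this file collects
the rank-generic, soliton-independent bookkeeping of the component tensor calculus
(`CoordTensorCalculus.lean`, `CoordTensorNorm.lean`, `CoordStarQuad.lean`) for a SINGLE metric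
`G` (`IsMetricOn G V`) at a positive definite point `x`:

* norms of traces, products, differences and finite sums (`sqrt_tnormSq_ttr_le`, `…_tprod`,
  `…_sum_le`; with `sqrt_tnormSq_sub_le`, `tinner_congr_apply`, `tnormSq_congr_point` of the imports);
* the Leibniz rule for a contracted first slot `∇_i(Σ_j c_j S_{j·}) = (∇_i c)^j S_{j·} + c_j (∇S)_{ij·}`
  (`tcov_sum_mul_ocons_apply`) and, for the gradient `c_j = bʲ(♯Df)`,
  `∂_i c_j + Γ^j_{im} c_m = g^{jk} Hess f(b_i, b_k)` (`IsMetricOn.fderiv_coord_sharpAt_add`);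
* `|Ric| ≤ √n |Rm|`, `|Ric ⋆ T| ≤ n |Rm| |T|`, `∇Ric = tr ∇Rm` and `|∇Ric| ≤ √n |∇Rm|`;
* the multilinear evaluation of `∇ rm4` (`IsMetricOn.frameComp_tcov_rm4`) and the orthonormal-frame
  formulas `|∇Rm|² = Σ G((∇_{e_k}R)(e_a,e_c)e_i, e_j)²` (`IsMetricOn.tnormSq_tcov_rm4_eq_sum_sq`),
  `|Rm|²_b = rmNormSqAt` (`IsMetricOn.tnormSq_rm4_eq_rmNormSqAt_of_frame`).

Everything is proved; no definition and no statement of `Prop` type is introduced.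

## References

* P. Topping, *Lectures on the Ricci flow*, LMS Lecture Note Series 325, CUP 2006, §2.1–§2.2
  (`∗`-notation), §3.2 (p. 37), §3.3 ((3.3.4)). [Topping2006]
* B. O'Neill, *Semi-Riemannian geometry with applications to relativity*, Academic Press 1983,
  Ch. 2, Prop. 2.13, Lemma 2.25 ff.; Ch. 3, Prop. 3.13, Prop. 3.37, Def. 3.48. [ONeill1983]
* O. Munteanu, J. Wang, *Geometry of shrinking Ricci solitons*, Compositio Math. 151 (2015)
  2273–2300 = arXiv:1410.3813, Thm. 1.4 (proof, p. 6) and Prop. 2.2 with (u1) (p. 7).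
  [MunteanuWang2015]
-/

noncomputable section

set_option maxSynthPendingDepth 3

open Set Filter ContinuousLinearMap Module Function
open scoped Topology ContDiff

namespace Literature.Geometry.Lorentzian

namespace MetricCoord

variable {E : Type*} [NormedAddCommGroup E] [NormedSpace ℝ E] {ι : Type*}

/-! ### Norm bookkeeping at a positive definite point -/

section NormHelpers

variable [Fintype ι] {G : E → E →L[ℝ] E →L[ℝ] ℝ} (b : Basis ι ℝ E) {x : E} [FiniteDimensional ℝ E]
  (hs : ∀ v w, G x v w = G x w v) (hpos : ∀ v, v ≠ 0 → 0 < G x v v)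
  {α β : Type*} [Fintype α] [DecidableEq α] [Fintype β] [DecidableEq β]
include hs hpos

/-- `|tr T| ≤ √n |T|`. [cite: Topping2006, §2.1] -/
theorem sqrt_tnormSq_ttr_le (T : E → (Option (Option α) → ι) → ℝ) :
    Real.sqrt (tnormSq G b (ttr G b T) x) ≤
      Real.sqrt (Fintype.card ι) * Real.sqrt (tnormSq G b T x) := by
  rw [← Real.sqrt_mul (Nat.cast_nonneg _)]
  exact Real.sqrt_le_sqrt (tnormSq_ttr_le b hs hpos T)

/-- `|S ⊗ T| = |S| |T|`. [cite: ONeill1983, Ch. 2, Lemma 2.31 ff.] -/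
theorem sqrt_tnormSq_tprod (S : E → (α → ι) → ℝ) (T : E → (β → ι) → ℝ) :
    Real.sqrt (tnormSq G b (tprod S T) x) =
      Real.sqrt (tnormSq G b S x) * Real.sqrt (tnormSq G b T x) := by
  rw [tnormSq_tprod, Real.sqrt_mul (tnormSq_nonneg b hs hpos _)]

/-- `|A − B − D + C| ≤ |A| + |B| + |D| + |C|`. [folklore] -/
theorem sqrt_tnormSq_sub_sub_add_le (A B D C : E → (α → ι) → ℝ) :
    Real.sqrt (tnormSq G b (A - B - D + C) x) ≤ Real.sqrt (tnormSq G b A x) + Real.sqrt (tnormSq G b B x)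
      + Real.sqrt (tnormSq G b D x) + Real.sqrt (tnormSq G b C x) := by
  have e1 := sqrt_tnormSq_add_le b hs hpos (A - B - D) C
  have e2 := sqrt_tnormSq_sub_le b hs hpos (A - B) D
  have e3 := sqrt_tnormSq_sub_le b hs hpos A B
  linarith

omit hs hpos in
/-- `|0|² = 0`. [folklore] -/
theorem tnormSq_zero : tnormSq G b (0 : E → (α → ι) → ℝ) x = 0 := by
  simp [tnormSq_eq, tinner_apply]

/-- `|Σ_c F_c| ≤ Σ_c |F_c|`. [folklore] -/
theorem sqrt_tnormSq_sum_le {κ : Type*} (s : Finset κ) (F : κ → E → (α → ι) → ℝ) :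
    Real.sqrt (tnormSq G b (∑ c ∈ s, F c) x) ≤ ∑ c ∈ s, Real.sqrt (tnormSq G b (F c) x) := by
  classical
  induction s using Finset.induction_on with
  | empty => simp [tnormSq_zero]
  | insert c s hc ih =>
    rw [Finset.sum_insert hc, Finset.sum_insert hc]
    exact (sqrt_tnormSq_add_le b hs hpos _ _).trans (by linarith)

/-- Cauchy–Schwarz with a norm bound on the first factor. [cite: Topping2006, §3.2, p. 37] -/
theorem abs_tinner_le_of_sqrt_le {S T : E → (α → ι) → ℝ} {M : ℝ}
    (hM : Real.sqrt (tnormSq G b S x) ≤ M) :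
    |tinner G b S T x| ≤ M * Real.sqrt (tnormSq G b T x) :=
  (abs_tinner_le b hs hpos S T).trans (mul_le_mul_of_nonneg_right hM (Real.sqrt_nonneg _))

end NormHelpers

/-! ### Contracted first slots: the Leibniz rule and the gradient vector field -/

section Drift

variable [Fintype ι] {G : E → E →L[ℝ] E →L[ℝ] ℝ} {b : Basis ι ℝ E} {α : Type*} [Fintype α] [DecidableEq α]
  {V : Set E} {x : E}

/-- **Leibniz rule for a contracted first slot**: for a smooth field `S` with a distinguished
first slot and smooth coefficients `c_j`, the covariant derivative of `I ↦ Σ_j c_j S_{jI}` is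
`(∇_i c)^j S_{jI} + c_j (∇S)_{ijI}` with `(∇_i c)^j = ∂_i c_j + Γ^j_{im} c_m` (the covariant
derivative of the vector field `Σ_j c_j b_j`). [cite: ONeill1983, Ch. 2, Prop. 2.13] -/
theorem tcov_sum_mul_ocons_apply (hV : IsOpen V) {S : E → (Option α → ι) → ℝ} (hS : TSmoothOn S V)
    {c : E → ι → ℝ} (hc : ∀ j, ContDiffOn ℝ ∞ (fun y ↦ c y j) V) (hx : x ∈ V) (i : ι) (I : α → ι) :
    tcov G b (fun y I ↦ ∑ j, c y j * S y (ocons j I)) x (ocons i I) =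
      ∑ j, (fderiv ℝ (fun y ↦ c y j) x (b i) + ∑ m, chrCoef G b x i m j * c x m) * S x (ocons j I)
        + ∑ j, c x j * tcov G b S x (ocons i (ocons j I)) := by
  have hcd : ∀ j, DifferentiableAt ℝ (fun y ↦ c y j) x := fun j ↦
    ((hc j).contDiffAt (hV.mem_nhds hx)).differentiableAt (by simp)
  have hSd : ∀ J, DifferentiableAt ℝ (fun y ↦ S y J) x := fun J ↦ hS.differentiableAt hV hx J
  have hD : fderiv ℝ (fun y ↦ ∑ j, c y j * S y (ocons j I)) x (b i) =
      ∑ j, fderiv ℝ (fun y ↦ c y j) x (b i) * S x (ocons j I)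
        + ∑ j, c x j * fderiv ℝ (fun y ↦ S y (ocons j I)) x (b i) := by
    rw [fderiv_fun_sum fun j _ ↦ (hcd j).fun_mul (hSd _), FunLike.coe_sum, Finset.sum_apply,
      ← Finset.sum_add_distrib]
    refine Finset.sum_congr rfl fun j _ ↦ ?_
    rw [fderiv_fun_mul (hcd j) (hSd _)]
    simp only [_root_.add_apply, _root_.smul_apply, smul_eq_mul]
    ring
  have hR : ∀ j, tcov G b S x (ocons i (ocons j I)) = fderiv ℝ (fun y ↦ S y (ocons j I)) x (b i)
      - ∑ m, chrCoef G b x i j m * S x (ocons m I)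
      - ∑ a, ∑ m, chrCoef G b x i (I a) m * S x (ocons j (update I a m)) := by
    intro j
    rw [tcov_apply_ocons, Fintype.sum_option]
    simp only [ocons_none, ocons_some, update_ocons_none, update_ocons_some]
    ring
  have h1 : ∑ j, (∑ m, chrCoef G b x i m j * c x m) * S x (ocons j I) =
      ∑ j, c x j * ∑ m, chrCoef G b x i j m * S x (ocons m I) := by
    simp only [Finset.sum_mul, Finset.mul_sum]
    rw [Finset.sum_comm]
    exact Finset.sum_congr rfl fun j _ ↦ Finset.sum_congr rfl fun m _ ↦ by ring
  have h2 : ∑ a, ∑ m, chrCoef G b x i (I a) m * ∑ j, c x j * S x (ocons j (update I a m)) =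
      ∑ j, c x j * ∑ a, ∑ m, chrCoef G b x i (I a) m * S x (ocons j (update I a m)) := by
    simp only [Finset.mul_sum]
    rw [sum_comm₃']
    exact Finset.sum_congr rfl fun j _ ↦ Finset.sum_congr rfl fun a _ ↦
      Finset.sum_congr rfl fun m _ ↦ by ring
  rw [tcov_apply_ocons, hD]
  simp only [hR, h2, add_mul, mul_sub, Finset.sum_add_distrib, Finset.sum_sub_distrib]
  rw [h1]
  ring

/-- `Σ_j bʲ(b_i) F_j = F_i`. [folklore] -/
theorem sum_coord_basis_mul (F : ι → ℝ) (i : ι) : ∑ j, b.coord j (b i) * F j = F i := by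
  classical
  simp only [Basis.coord_apply, Basis.repr_self, Finsupp.single_apply]
  simp

variable [FiniteDimensional ℝ E]

/-- `⟨Σ_q w_q S_{q·}, T⟩ = Σ_q w_q ⟨S_{q·}, T⟩`. [folklore] -/
theorem tinner_sum_mul_ocons (w : ι → ℝ) (S : E → (Option α → ι) → ℝ) (T : E → (α → ι) → ℝ) :
    tinner G b (fun y I ↦ ∑ q, w q * S y (ocons q I)) T x =
      ∑ q, w q * tinner G b (fun y I ↦ S y (ocons q I)) T x := by
  simp only [tinner_apply, Finset.mul_sum, Finset.sum_mul]
  rw [sum_comm₃']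
  exact Finset.sum_congr rfl fun q _ ↦ Finset.sum_congr rfl fun I _ ↦
    Finset.sum_congr rfl fun J _ ↦ by ring

variable [CompleteSpace E]

/-- **The covariant derivative of the gradient `∇f = ♯Df` in the basis**: with
`c_j = bʲ(♯Df) = Σ_k g^{jk} ∂_k f`, `∂_i c_j + Γ^j_{im} c_m = Σ_k g^{jk} Hess f(b_i, b_k)`
(`∇ g⁻¹ = 0`). [cite: ONeill1983, Ch. 3, Def. 3.48] -/
theorem IsMetricOn.fderiv_coord_sharpAt_add (hG : IsMetricOn G V) (hx : x ∈ V) {f : E → ℝ}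
    (hf : ContDiffOn ℝ ∞ f V) (i j : ι) :
    fderiv ℝ (fun y ↦ b.coord j (sharpAt G y (fderiv ℝ f y))) x (b i)
      + ∑ m, chrCoef G b x i m j * b.coord m (sharpAt G x (fderiv ℝ f x)) =
      ∑ k, ginv G b x j k * hessAt G f x (b i) (b k) := by
  have hfun : (fun y ↦ b.coord j (sharpAt G y (fderiv ℝ f y))) =
      fun y ↦ ∑ k, ginv G b y j k * fderiv ℝ f y (b k) := by
    funext y; exact coord_sharpAt_eq_sum b _ j
  have hgd : ∀ p q, DifferentiableAt ℝ (fun y ↦ ginv G b y p q) x := fun p q ↦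
    ((hG.contDiffOn_ginv b p q).contDiffAt (hG.isOpen.mem_nhds hx)).differentiableAt (by simp)
  have hfd : DifferentiableAt ℝ (fderiv ℝ f) x :=
    ((hf.fderiv_of_isOpen (m := ∞) hG.isOpen (by simp)).contDiffAt (hG.mem_nhds hx)).differentiableAt
      (by simp)
  have hfk : ∀ k, DifferentiableAt ℝ (fun y ↦ fderiv ℝ f y (b k)) x := fun k ↦
    differentiableAt_clm_apply_const hfd (b k)
  rw [hfun, fderiv_fun_sum (fun k _ ↦ (hgd j k).fun_mul (hfk k)), FunLike.coe_sum, Finset.sum_apply]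
  simp only [fderiv_fun_mul (hgd j _) (hfk _), _root_.add_apply, _root_.smul_apply, smul_eq_mul,
    fderiv_clm_apply_const hfd, hG.fderiv_ginv_eq_chrCoef b hx, coord_sharpAt_eq_sum b, hessAt_apply,
    chrAt_basis_eq_sum b x i, map_sum, map_smul]
  have e1 : ∑ k, (∑ c, ginv G b x j c * chrCoef G b x i c k) * fderiv ℝ f x (b k) =
      ∑ k, ginv G b x j k * ∑ m, chrCoef G b x i k m * fderiv ℝ f x (b m) := by
    simp only [Finset.sum_mul, Finset.mul_sum]
    rw [Finset.sum_comm]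
    exact Finset.sum_congr rfl fun k _ ↦ Finset.sum_congr rfl fun m _ ↦ by ring
  have e2 : ∑ k, (∑ d, chrCoef G b x i d j * ginv G b x d k) * fderiv ℝ f x (b k) =
      ∑ m, chrCoef G b x i m j * ∑ k, ginv G b x m k * fderiv ℝ f x (b k) := by
    simp only [Finset.sum_mul, Finset.mul_sum]
    rw [Finset.sum_comm]
    exact Finset.sum_congr rfl fun k _ ↦ Finset.sum_congr rfl fun m _ ↦ by ring
  have e4 : ∑ k, (ginv G b x j k * fderiv ℝ (fderiv ℝ f) x (b i) (b k) + fderiv ℝ f x (b k) *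
      (-(∑ c, ginv G b x j c * chrCoef G b x i c k) - ∑ d, chrCoef G b x i d j * ginv G b x d k)) =
      ∑ k, ginv G b x j k * fderiv ℝ (fderiv ℝ f) x (b i) (b k)
        - ∑ k, (∑ c, ginv G b x j c * chrCoef G b x i c k) * fderiv ℝ f x (b k)
        - ∑ k, (∑ d, chrCoef G b x i d j * ginv G b x d k) * fderiv ℝ f x (b k) := by
    rw [← Finset.sum_sub_distrib, ← Finset.sum_sub_distrib]
    exact Finset.sum_congr rfl fun k _ ↦ by ring
  have e5 : ∑ k, ginv G b x j k * (fderiv ℝ (fderiv ℝ f) x (b i) (b k)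
      - ∑ m, chrCoef G b x i k m * fderiv ℝ f x (b m)) =
      ∑ k, ginv G b x j k * fderiv ℝ (fderiv ℝ f) x (b i) (b k)
        - ∑ k, ginv G b x j k * ∑ m, chrCoef G b x i k m * fderiv ℝ f x (b m) := by
    rw [← Finset.sum_sub_distrib]
    exact Finset.sum_congr rfl fun k _ ↦ by ring
  rw [e4, e5, e1, e2]
  ring

omit [Fintype ι] in
/-- The coefficients `y ↦ bʲ(♯Df(y))` of the gradient are `C^∞` on `V`. [folklore] -/
theorem IsMetricOn.contDiffOn_coord_sharpAt_fderiv (hG : IsMetricOn G V) {f : E → ℝ}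
    (hf : ContDiffOn ℝ ∞ f V) (q : ι) :
    ContDiffOn ℝ ∞ (fun y ↦ b.coord q (sharpAt G y (fderiv ℝ f y))) V := by
  have h1 : ContDiffOn ℝ ∞ (fun y ↦ sharpAt G y (fderiv ℝ f y)) V :=
    hG.contDiffOn_sharpAt.clm_apply (hf.fderiv_of_isOpen (m := ∞) hG.isOpen (by simp))
  exact (coordCLM b q).contDiff.comp_contDiffOn h1

end Drift

/-! ### `Ric`, `∇Ric` and the Ricci action against `|Rm|`, `|∇Rm|` -/

section RicBounds

variable [Fintype ι] {G : E → E →L[ℝ] E →L[ℝ] ℝ} (b : Basis ι ℝ E) {V : Set E} {x : E}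
  [FiniteDimensional ℝ E] {α : Type*} [Fintype α] [DecidableEq α]

/-- `|Ric| ≤ √n |Rm|` (`Ric = tr Rm`). [cite: Topping2006, Prop. 3.2.10 (proof)] -/
theorem IsMetricOn.sqrt_tnormSq_ric2_le (hG : IsMetricOn G V) (hx : x ∈ V)
    (hpos : ∀ v, v ≠ 0 → 0 < G x v v) :
    Real.sqrt (tnormSq G b (ric2 G b) x) ≤
      Real.sqrt (Fintype.card ι) * Real.sqrt (tnormSq G b (rm4 G b) x) := by
  have hs := hG.symm x hx
  rw [IsMetricFamilyOn.tnormSq_congr_point b fun I ↦ ric2_eq_ttr b (hG.isInvertible x hx) I]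
  refine (sqrt_tnormSq_ttr_le b hs hpos _).trans ?_
  rw [tnormSq_treindex]

/-- `|Ric ⋆_a T| ≤ n |Rm| |T|` for the Ricci action `ricSlot` on a slot of `T`.
[cite: Topping2006, Prop. 3.2.10 (proof)] -/
theorem IsMetricOn.sqrt_tnormSq_ricSlot_le (hG : IsMetricOn G V) (hx : x ∈ V)
    (hpos : ∀ v, v ≠ 0 → 0 < G x v v) (T : E → (α → ι) → ℝ) (a : α) :
    Real.sqrt (tnormSq G b (ricSlot G b T a) x) ≤
      Fintype.card ι * Real.sqrt (tnormSq G b (rm4 G b) x) * Real.sqrt (tnormSq G b T x) := by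
  have hs := hG.symm x hx
  have hn : Real.sqrt (Fintype.card ι) * Real.sqrt (Fintype.card ι) = Fintype.card ι :=
    Real.mul_self_sqrt (Nat.cast_nonneg _)
  rw [IsMetricFamilyOn.tnormSq_congr_point b fun I ↦ ricSlot_eq_ttr b T a x I]
  calc Real.sqrt (tnormSq G b (ttr G b (treindex (slotEquiv a) (tprod (ric2 G b) T))) x)
      ≤ Real.sqrt (Fintype.card ι) *
          Real.sqrt (tnormSq G b (treindex (slotEquiv a) (tprod (ric2 G b) T)) x) :=
        sqrt_tnormSq_ttr_le b hs hpos _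
    _ = Real.sqrt (Fintype.card ι) * (Real.sqrt (tnormSq G b (ric2 G b) x) * Real.sqrt (tnormSq G b T x)) := by
        rw [tnormSq_treindex, sqrt_tnormSq_tprod b hs hpos]
    _ ≤ Real.sqrt (Fintype.card ι) * ((Real.sqrt (Fintype.card ι) * Real.sqrt (tnormSq G b (rm4 G b) x))
          * Real.sqrt (tnormSq G b T x)) := by
        gcongr
        exact hG.sqrt_tnormSq_ric2_le b hx hpos
    _ = _ := by
        linear_combination (Real.sqrt (tnormSq G b (rm4 G b) x) * Real.sqrt (tnormSq G b T x)) * hn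

variable [CompleteSpace E]

/-- **`∇Ric = tr ∇Rm` in components**: `∇ ric2 = tr ((∇ rm4) ∘ e)` at the points of `V`.
[cite: ONeill1983, Ch. 3, Prop. 3.13] -/
theorem IsMetricOn.tcov_ric2_eq_ttr (hG : IsMetricOn G V) (hx : x ∈ V) (K : Option (Fin 2) → ι) :
    tcov G b (ric2 G b) x K = ttr G b (treindex (cycTop (Fin 2))
      (treindex ricTraceEquiv.optionCongr (tcov G b (rm4 G b)))) x K := by
  rw [tcov_congr hG.isOpen (fun z hz I ↦ ric2_eq_ttr b (hG.isInvertible z hz) I) hx K,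
    hG.tcov_ttr_eq ((hG.tsmoothOn_rm4 b).treindex _) hx K, tcov_treindex]

/-- `|∇Ric| ≤ √n |∇Rm|`. [cite: Topping2006, §2.2] -/
theorem IsMetricOn.sqrt_tnormSq_tcov_ric2_le (hG : IsMetricOn G V) (hx : x ∈ V)
    (hpos : ∀ v, v ≠ 0 → 0 < G x v v) :
    Real.sqrt (tnormSq G b (tcov G b (ric2 G b)) x) ≤
      Real.sqrt (Fintype.card ι) * Real.sqrt (tnormSq G b (tcov G b (rm4 G b)) x) := by
  have hs := hG.symm x hx
  rw [IsMetricFamilyOn.tnormSq_congr_point b fun K ↦ hG.tcov_ric2_eq_ttr b hx K]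
  refine (sqrt_tnormSq_ttr_le b hs hpos _).trans ?_
  rw [tnormSq_treindex, tnormSq_treindex]

end RicBounds

/-! ### `∇ rm4` evaluated multilinearly; `|∇Rm|²` and `|Rm|²` in an orthonormal frame -/

section Bridge

variable [Fintype ι] {G : E → E →L[ℝ] E →L[ℝ] ℝ} (b : Basis ι ℝ E) {V : Set E} {x : E} [CompleteSpace E]

/-- **The drift term of `rm4` through `covRiemAt`**: at `x ∈ V`, for every vector `v`,
`Σ_q b^q(v) (∇ rm4)_{q,J} = G((∇_v R)(b_{J0},b_{J1})b_{J2}, b_{J3})`. [cite: ONeill1983, Ch. 3, Prop. 3.37] -/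
theorem IsMetricOn.sum_coord_mul_tcov_rm4 (hG : IsMetricOn G V) (hx : x ∈ V) (v : E) (J : Fin 4 → ι) :
    ∑ q, b.coord q v * tcov G b (rm4 G b) x (ocons q J) =
      G x (covRiemAt G x v (b (J 0)) (b (J 1)) (b (J 2))) (b (J 3)) := by
  have h : ∀ q, tcov G b (rm4 G b) x (ocons q J) =
      G x (covRiemAt G x (b q) (b (J 0)) (b (J 1)) (b (J 2))) (b (J 3)) := by
    intro q
    conv_lhs => rw [eq_vec4 J]
    exact hG.tcov_rm4 b hx q (J 0) (J 1) (J 2) (J 3)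
  simp only [h, ← hG.covRiemCLM_apply hx]
  conv_rhs => rw [← sum_coord_smul b v]
  simp only [map_sum, map_smul, _root_.sum_apply, _root_.smul_apply, smul_eq_mul]

/-- `(∇rm4)(b_m; v₀,v₁,v₂,v₃) = G((∇_{b_m}R)(v₀,v₁)v₂, v₃)`, multilinearly in `v`.
[cite: ONeill1983, Ch. 3, Prop. 3.37] -/
theorem IsMetricOn.frameComp_tcov_rm4_ocons (hG : IsMetricOn G V) (hx : x ∈ V) (m : ι) (v : Fin 4 → E) :
    frameComp b (fun I ↦ tcov G b (rm4 G b) x (ocons m I)) v =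
      G x (covRiemAt G x (b m) (v 0) (v 1) (v 2)) (v 3) := by
  have hfun : (fun I : Fin 4 → ι ↦ tcov G b (rm4 G b) x (ocons m I)) =
      fun I ↦ G x (covRiemAt G x (b m) (b (I 0)) (b (I 1)) (b (I 2))) (b (I 3)) := by
    funext I
    conv_lhs => rw [eq_vec4 I]
    exact hG.tcov_rm4 b hx m _ _ _ _
  rw [hfun]
  have h0 : ∀ v1 v2 v3 : E, IsLinearMap ℝ fun u ↦ G x (covRiemAt G x (b m) u v1 v2) v3 := fun v1 v2 v3 ↦
    ⟨fun u u' ↦ by rw [hG.covRiemAt_add_mid hx, _root_.add_apply, map_add, _root_.add_apply],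
     fun c u ↦ by rw [hG.covRiemAt_smul_mid hx, _root_.smul_apply, map_smul, _root_.smul_apply, smul_eq_mul]⟩
  have h1 : ∀ v0 v2 v3 : E, IsLinearMap ℝ fun u ↦ G x (covRiemAt G x (b m) v0 u v2) v3 := fun v0 v2 v3 ↦
    ⟨fun u u' ↦ by rw [hG.covRiemAt_add_right hx, _root_.add_apply, map_add, _root_.add_apply],
     fun c u ↦ by rw [hG.covRiemAt_smul_right hx, _root_.smul_apply, map_smul, _root_.smul_apply, smul_eq_mul]⟩
  have h2 : ∀ v0 v1 v3 : E, IsLinearMap ℝ fun u ↦ G x (covRiemAt G x (b m) v0 v1 u) v3 := fun v0 v1 v3 ↦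
    ⟨fun u u' ↦ by rw [map_add, map_add, _root_.add_apply],
     fun c u ↦ by rw [map_smul, map_smul, _root_.smul_apply, smul_eq_mul]⟩
  have h3 : ∀ v0 v1 v2 : E, IsLinearMap ℝ fun u ↦ G x (covRiemAt G x (b m) v0 v1 v2) u := fun v0 v1 v2 ↦
    ⟨fun u u' ↦ by rw [map_add], fun c u ↦ by rw [map_smul, smul_eq_mul]⟩
  exact frameComp_multilinear b (MultilinearMap.ofFin4 _ h0 h1 h2 h3) v

/-- **The components `∇ rm4` evaluate multilinearly to `∇R`**:
`(∇rm4)(v) = G((∇_{v_*}R)(v₀,v₁)v₂, v₃)`. [cite: ONeill1983, Ch. 3, Prop. 3.37] -/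
theorem IsMetricOn.frameComp_tcov_rm4 (hG : IsMetricOn G V) (hx : x ∈ V) (v : Option (Fin 4) → E) :
    frameComp b (tcov G b (rm4 G b) x) v =
      G x (covRiemAt G x (v none) (v (some 0)) (v (some 1)) (v (some 2))) (v (some 3)) := by
  rw [frameComp_option]
  simp only [hG.frameComp_tcov_rm4_ocons b hx, Function.comp_apply, ← hG.covRiemCLM_apply hx]
  conv_rhs => rw [← sum_coord_smul b (v none)]
  simp only [map_sum, map_smul, _root_.sum_apply, _root_.smul_apply, smul_eq_mul]

variable [FiniteDimensional ℝ E]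

/-- **`|∇Rm|²` in an orthonormal frame**: `|∇ rm4|²_g = Σ_{kacij} G((∇_{e_k}R)(e_a,e_c)e_i, e_j)²`
for any basis `b` and any `G x`-orthonormal `e` (Parseval, `tnormSq_eq_sum_sq_frame`).
[cite: Topping2006, §3.2, p. 37] -/
theorem IsMetricOn.tnormSq_tcov_rm4_eq_sum_sq {κ : Type*} [Fintype κ] [DecidableEq κ] (hG : IsMetricOn G V)
    (hx : x ∈ V) (e : Basis κ ℝ E) (he : ∀ c d, G x (e c) (e d) = if c = d then 1 else 0) :
    tnormSq G b (tcov G b (rm4 G b)) x =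
      ∑ k, ∑ a, ∑ c, ∑ i, ∑ j, (G x (covRiemAt G x (e k) (e a) (e c) (e i)) (e j)) ^ 2 := by
  rw [tnormSq_eq_sum_sq_frame b e he (hG.isInvertible x hx) (hG.symm x hx), sum_optionIndex]
  simp only [hG.frameComp_tcov_rm4 b hx, Function.comp_apply, ocons_none, ocons_some, sum_finSuccIndex,
    Fintype.sum_unique]
  rfl

/-- **`|Rm|²` of the component calculus is `rmNormSqAt`**, given a `G x`-orthonormal frame
(the variant of `tnormSq_rm4_eq_rmNormSqAt` with the frame as a datum). [cite: Topping2006, §3.2, (3.2.4)] -/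
theorem IsMetricOn.tnormSq_rm4_eq_rmNormSqAt_of_frame {κ : Type*} [Fintype κ] [DecidableEq κ]
    (hG : IsMetricOn G V) (hx : x ∈ V) (e : Basis κ ℝ E) (he : ∀ c d, G x (e c) (e d) = if c = d then 1 else 0) :
    tnormSq G b (rm4 G b) x = rmNormSqAt G x := by
  rw [tnormSq_eq_sum_sq_frame b e he (hG.isInvertible x hx) (hG.symm x hx), hG.rmNormSqAt_eq_sum_sq e he hx]
  simp only [frameComp_rm4, Function.comp_apply, sum_finSuccIndex, Fintype.sum_unique]
  rfl

end Bridge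

end MetricCoord

end Literature.Geometry.Lorentzian

end
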